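import Mathlib
import HarnessLib
import Summits.MatrixMultiplication.MatrixMultiplication.Theorems.OutsiderSandwichPencilSpan

/-!
# OutsiderSandwich — pencil calculus for powers of the diagonalised CW tensor, IIc: the 2-pencil span law
(decomp-mm lens 4 «minimal-counterexample / extremal reduction», gen 38, kernel K38-2c; THESES-FREE,
DEFINITION-FREE — conventions of Parts I/II)

**Span law `B(N)`** (`pencil_span`): for linearly independent covectors `ζ, ζ'` on words of length `N`
over the diagonalised Coppersmith–Winograd tensor `D` (`D a b c = [a, b, c pairwise distinct]`, isomorphic
to `cw₂` over `ℂ`),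
`3 · 2^N ≤ 2 · dim (col T_N(ζ) + col T_N(ζ'))`.
So a `2`-pencil of slices of `D^{⊠N}` (equivalently of `cw₂^{⊠N}`) can never sit inside a common column
space of dimension `< 1.5 · 2^N`, although every single slice can have rank exactly `2^N`: the extremal
(minrank) slices are isolated in this sense.  Proof: induction on `N`; the step (`span_step`) runs
through the members `θ = sζ + tζ'` of the pencil — a member of rank `≥ 3 · 2^N` suffices; otherwise every
member has a vanishing component and a dependent pair of remaining components (Part II: `rank_of_comps_ne_zero`,
`pair_bound`), a letter vanishes on the whole pencil (`exists_common_zero`), and the pencil is in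
configuration A (`dep_scalar`, `caseA_bound`) or B (`caseB_bound`), where the induction hypothesis resp.
the minrank bound `2^N` applies inside the blocks.

Corollaries: `three_two_pow_le_rank_of_comps` (all three components non-zero ⇒ `rank ≥ 3 · 2^N`) and
`three_two_pow_le_rank_of_pair` (an independent pair of components ⇒ `rank ≥ 3 · 2^N`) — the two
sources of rank `1.5 ×` minrank used by the pencil law (Part III).

References: [cite: CoppersmithWinograd1990, §6]; [cite: Roy1995, §1]; [cite: HornJohnson2013, §0.4];
[cite: BlaserIkenmeyerLysikovPandeySchreyer2019, §5].
-/

set_option linter.dupNamespace false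

noncomputable section

namespace Summit.MatrixMultiplication.MatrixMultiplication.Theorems.OutsiderSandwichPencilSpanLaw

open Literature.Computability.AlgebraicComplexity
open Summit.MatrixMultiplication.MatrixMultiplication.Theorems.OutsiderSandwichPencilBlocks
open Summit.MatrixMultiplication.MatrixMultiplication.Theorems.OutsiderSandwichPencilSpan
open scoped Matrix BigOperators

variable {D : Fin 3 → Fin 3 → Fin 3 → ℂ}

/-- **Induction step of the span law**: `B(N) ⇒ B(N+1)`. [cite: CoppersmithWinograd1990, §6] -/
theorem span_step (hD : ∀ a b c, D a b c = if a ≠ b ∧ b ≠ c ∧ a ≠ c then 1 else 0) (N : ℕ)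
    (ihB : ∀ ζ ζ' : (Fin N → Fin 3) → ℂ, LinearIndependent ℂ ![ζ, ζ'] →
      3 * 2 ^ N ≤ 2 * Module.finrank ℂ ↥(LinearMap.range (contract3 (kroneckerPow D N) ζ).mulVecLin ⊔
        LinearMap.range (contract3 (kroneckerPow D N) ζ').mulVecLin))
    (ζ ζ' : (Fin (N + 1) → Fin 3) → ℂ) (hind : LinearIndependent ℂ ![ζ, ζ']) :
    3 * 2 ^ (N + 1) ≤ 2 * Module.finrank ℂ ↥(LinearMap.range (contract3 (kroneckerPow D (N + 1)) ζ).mulVecLin ⊔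
        LinearMap.range (contract3 (kroneckerPow D (N + 1)) ζ').mulVecLin) := by
  set V := LinearMap.range (contract3 (kroneckerPow D (N + 1)) ζ).mulVecLin ⊔
    LinearMap.range (contract3 (kroneckerPow D (N + 1)) ζ').mulVecLin with hV
  have hpow : 2 ^ (N + 1) = 2 * 2 ^ N := by ring
  -- every member of the pencil has its column space inside `V`
  have hrc : ∀ s t : ℂ, LinearMap.range (contract3 (kroneckerPow D (N + 1)) (s • ζ + t • ζ')).mulVecLin ≤ V := by
    intro s t
    rw [slice_add, slice_smul, slice_smul]
    exact range_comb_le _ _ s t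
  have hcomb : ∀ s t : ℂ, (contract3 (kroneckerPow D (N + 1)) (s • ζ + t • ζ')).rank ≤ Module.finrank ℂ ↥V :=
    fun s t => Submodule.finrank_mono (hrc s t)
  by_cases hbig : ∃ s t : ℂ, 3 * 2 ^ N ≤ (contract3 (kroneckerPow D (N + 1)) (s • ζ + t • ζ')).rank
  · obtain ⟨s, t, hst⟩ := hbig
    have := hcomb s t
    omega
  push Not at hbig
  -- (1) every member has a vanishing component
  have hzero : ∀ s t : ℂ, s ≠ 0 ∨ t ≠ 0 → ∃ d : Fin 3,
      s • (fun v : Fin N → Fin 3 => ζ (Fin.cons d v)) + t • (fun v => ζ' (Fin.cons d v)) = 0 := by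
    intro s t _
    by_contra hne
    push Not at hne
    have h := rank_of_comps_ne_zero hD N ihB (s • ζ + t • ζ') (fun d => by rw [comp_comb]; exact hne d)
    exact absurd h (not_le.mpr (hbig s t))
  -- (2) hence a common vanishing letter `a`
  obtain ⟨a, hζa, hζ'a⟩ := exists_common_zero (fun d => fun v : Fin N → Fin 3 => ζ (Fin.cons d v))
    (fun d => fun v : Fin N → Fin 3 => ζ' (Fin.cons d v)) hzero
  obtain ⟨hab, hbc, hac⟩ := succ_letters a
  -- (3) no member has an independent pair of `(a+1, a+2)`-components
  have hdep : ∀ s t : ℂ, ¬ LinearIndependent ℂ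
      ![s • (fun v : Fin N → Fin 3 => ζ (Fin.cons (a + 1) v)) + t • (fun v => ζ' (Fin.cons (a + 1) v)),
        s • (fun v : Fin N → Fin 3 => ζ (Fin.cons (a + 2) v)) + t • (fun v => ζ' (Fin.cons (a + 2) v))] := by
    intro s t hli
    have h1 := pair_bound hD N (s • ζ + t • ζ') hab hbc hac
    rw [comp_comb, comp_comb] at h1
    have h2 := ihB _ _ hli
    exact absurd (h2.trans h1) (not_le.mpr (hbig s t))
  have hdep' : ∀ s t : ℂ, ¬ LinearIndependent ℂ
      ![s • (fun v : Fin N → Fin 3 => ζ (Fin.cons (a + 2) v)) + t • (fun v => ζ' (Fin.cons (a + 2) v)),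
        s • (fun v : Fin N → Fin 3 => ζ (Fin.cons (a + 1) v)) + t • (fun v => ζ' (Fin.cons (a + 1) v))] := by
    intro s t hli
    exact hdep s t (LinearIndependent.pair_symm_iff.mp hli)
  by_cases hB : LinearIndependent ℂ ![(fun v : Fin N → Fin 3 => ζ (Fin.cons (a + 1) v)),
    (fun v : Fin N → Fin 3 => ζ' (Fin.cons (a + 1) v))]
  · -- configuration A: the `(a+2)`-components are `r •` the `(a+1)`-components
    obtain ⟨r, hr, hr'⟩ := dep_scalar hB hdep
    have hA := caseA_bound hD N hab hbc hac ζ ζ' r hζa hζ'a hr hr'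
    rw [← hV] at hA
    have h2 := ihB _ _ hB
    omega
  by_cases hC : LinearIndependent ℂ ![(fun v : Fin N → Fin 3 => ζ (Fin.cons (a + 2) v)),
    (fun v : Fin N → Fin 3 => ζ' (Fin.cons (a + 2) v))]
  · -- configuration A with the roles of `a+1` and `a+2` exchanged
    obtain ⟨r, hr, hr'⟩ := dep_scalar hC hdep'
    have hA := caseA_bound hD N hac (Ne.symm hbc) hab ζ ζ' r hζa hζ'a hr hr'
    rw [← hV] at hA
    have h2 := ihB _ _ hC
    omega
  -- configuration B: both component pairs are dependent
  rw [LinearIndependent.pair_iff] at hB hC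
  push Not at hB hC
  obtain ⟨s₁, t₁, h1, hst₁⟩ := hB
  obtain ⟨s₂, t₂, h2, hst₂⟩ := hC
  have h1a : (fun v : Fin N → Fin 3 => (s₁ • ζ + t₁ • ζ') (Fin.cons a v)) = 0 := by
    rw [comp_comb, hζa, hζ'a, smul_zero, smul_zero, add_zero]
  have h1b : (fun v : Fin N → Fin 3 => (s₁ • ζ + t₁ • ζ') (Fin.cons (a + 1) v)) = 0 := by
    rw [comp_comb]; exact h1
  have h2a : (fun v : Fin N → Fin 3 => (s₂ • ζ + t₂ • ζ') (Fin.cons a v)) = 0 := by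
    rw [comp_comb, hζa, hζ'a, smul_zero, smul_zero, add_zero]
  have h2c : (fun v : Fin N → Fin 3 => (s₂ • ζ + t₂ • ζ') (Fin.cons (a + 2) v)) = 0 := by
    rw [comp_comb]; exact h2
  have hne : ∀ s t : ℂ, (s = 0 → t ≠ 0) → s • ζ + t • ζ' ≠ 0 := fun s t hst h0 =>
    hst ((LinearIndependent.pair_iff.mp hind) s t h0).1 ((LinearIndependent.pair_iff.mp hind) s t h0).2
  have h1c : (fun v : Fin N → Fin 3 => (s₁ • ζ + t₁ • ζ') (Fin.cons (a + 2) v)) ≠ 0 := by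
    intro h0
    refine hne s₁ t₁ hst₁ (eq_zero_of_comp_eq_zero fun d => ?_)
    rcases eq_or_ne d a with rfl | hd
    · exact h1a
    rcases letter_eq_or _ d _ _ hab hbc hac hd with rfl | rfl
    exacts [h1b, h0]
  have h2b : (fun v : Fin N → Fin 3 => (s₂ • ζ + t₂ • ζ') (Fin.cons (a + 1) v)) ≠ 0 := by
    intro h0
    refine hne s₂ t₂ hst₂ (eq_zero_of_comp_eq_zero fun d => ?_)
    rcases eq_or_ne d a with rfl | hd
    · exact h2a
    rcases letter_eq_or _ d _ _ hab hbc hac hd with rfl | rfl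
    exacts [h0, h2c]
  have hBd := caseB_bound hD N hab hbc hac (s₁ • ζ + t₁ • ζ') (s₂ • ζ + t₂ • ζ') h1a h1b h2c
  have hr1 := two_pow_le_rank_slice hD N h1c
  have hr2 := two_pow_le_rank_slice hD N h2b
  have hmono : Module.finrank ℂ ↥(LinearMap.range (contract3 (kroneckerPow D (N + 1)) (s₁ • ζ + t₁ • ζ')).mulVecLin ⊔
      LinearMap.range (contract3 (kroneckerPow D (N + 1)) (s₂ • ζ + t₂ • ζ')).mulVecLin) ≤ Module.finrank ℂ ↥V :=
    Submodule.finrank_mono (sup_le (hrc s₁ t₁) (hrc s₂ t₂))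
  omega

/-- **The 2-pencil span law** for the diagonalised Coppersmith–Winograd tensor: for linearly
independent covectors `ζ, ζ'`, `3 · 2^N ≤ 2 · dim (col T_N(ζ) + col T_N(ζ'))`.
[cite: CoppersmithWinograd1990, §6] -/
theorem pencil_span (hD : ∀ a b c, D a b c = if a ≠ b ∧ b ≠ c ∧ a ≠ c then 1 else 0) :
    ∀ (N : ℕ) (ζ ζ' : (Fin N → Fin 3) → ℂ), LinearIndependent ℂ ![ζ, ζ'] →
      3 * 2 ^ N ≤ 2 * Module.finrank ℂ ↥(LinearMap.range (contract3 (kroneckerPow D N) ζ).mulVecLin ⊔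
        LinearMap.range (contract3 (kroneckerPow D N) ζ').mulVecLin) := by
  intro N
  induction N with
  | zero =>
    intro ζ ζ' hind
    exfalso
    have h := hind.fintype_card_le_finrank
    simp at h
  | succ N ih => exact span_step hD N ih

/-- **Rank `1.5 ×` minrank from non-vanishing components**: if `θ_0, θ_1, θ_2 ≠ 0` then
`rank T_{N+1}(θ) ≥ 3 · 2^N`. [cite: CoppersmithWinograd1990, §6] -/
theorem three_two_pow_le_rank_of_comps (hD : ∀ a b c, D a b c = if a ≠ b ∧ b ≠ c ∧ a ≠ c then 1 else 0)
    (N : ℕ) (θ : (Fin (N + 1) → Fin 3) → ℂ) (hθ : ∀ a : Fin 3, (fun v : Fin N → Fin 3 => θ (Fin.cons a v)) ≠ 0) :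
    3 * 2 ^ N ≤ (contract3 (kroneckerPow D (N + 1)) θ).rank :=
  rank_of_comps_ne_zero hD N (pencil_span hD N) θ hθ

/-- **Rank `1.5 ×` minrank from an independent pair of components**: if `θ_b, θ_c` are linearly
independent (`b ≠ c`) then `rank T_{N+1}(θ) ≥ 3 · 2^N`. [cite: Roy1995, §1] -/
theorem three_two_pow_le_rank_of_pair (hD : ∀ a b c, D a b c = if a ≠ b ∧ b ≠ c ∧ a ≠ c then 1 else 0)
    (N : ℕ) (θ : (Fin (N + 1) → Fin 3) → ℂ) {a b c : Fin 3} (hab : a ≠ b) (hbc : b ≠ c) (hac : a ≠ c)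
    (hind : LinearIndependent ℂ ![(fun v : Fin N → Fin 3 => θ (Fin.cons b v)), (fun v => θ (Fin.cons c v))]) :
    3 * 2 ^ N ≤ (contract3 (kroneckerPow D (N + 1)) θ).rank :=
  (pencil_span hD N _ _ hind).trans (pair_bound hD N θ hab hbc hac)

end Summit.MatrixMultiplication.MatrixMultiplication.Theorems.OutsiderSandwichPencilSpanLaw
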